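import Summits.ValiantsHypothesis.ValiantsHypothesis.Theorems.KPlusLogSqLawLiftingThinStrip
import Summits.ValiantsHypothesis.ValiantsHypothesis.Theorems.KPlusLogSqLawTropicalBPadding
import Summits.ValiantsHypothesis.ValiantsHypothesis.Theorems.KPlusLogSqLawTropicalGradedWalkChainThree
import Summits.ValiantsHypothesis.ValiantsHypothesis.Theorems.LacunarySymmetroidMatrixDescartesDegreeCeiling

/-!
# Route «KPlusLogSqLaw», crux `Lifting` / `WeakLifting` — LIFT with constant `C = 3` holds at EVERY format `(m, K)` on all pencils of
# height `≤ 2^(3K+1)·m`; a counterexample to LIFT-with-`C = 3` is a lacunary pencil (`K ≥ 4`, `m ≥ 2`, some exponent `> 2^(3K+1)·m`)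

HONEST FRAMING.  Helper (location bookkeeping, no stub credit) toward the lifting cruxes of route `KPlusLogSqLaw`
(`Summit.ValiantsHypothesis.ValiantsHypothesis.Theses.KPlusLogSqLaw.Lifting`, item `stmt-ValiantsHypothesis-19772`, which implies
`…KPlusLogSqLaw.WeakLifting`, item `stmt-ValiantsHypothesis-19561`); cell `pub-symmetroid`, seat val-sym-lift-p3 g24, 2026-08-29.
`Lifting` asks for an absolute `C` with `TropRootLawAt m K n → RealRootLawAt m K (2^(C·K)·(n+1))` at every format; its registered
skeleton (`Cruxes/Lifting/Lines/birth.lean`) runs with `C = 3`, and the tree has the rungs `K ≤ 3` for all `m` (`lift_strip_le_three`,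
val-sym-lift-p1) and `K = 4` for `m ≤ 24569` (`lift_rung_four_of_le_grw3`); beyond, every fixed `K ≥ 4` is the cell's growth fork.  This file
records the SUPPORT-RESTRICTED form of the whole statement that IS a theorem: on pencils whose exponents are at most `2^(3K+1)·m` the
inequality of LIFT-with-`C = 3` holds at EVERY format, because the tree's degree ceiling (`card_roots_det_pencil_le_degree`: `≤ m·D` real
zeros for height `D`) fits under the budget `2^(3K)·(n+1)` as soon as the tropical row is at least quadratic — which it is for `K ≥ 4`,
`m ≥ 2` by class padding (`tropRootLawAt_of_le_classes`) and the kernel GRW floor `2m² ≤ n` (`grw3_le_of_tropRootLawAt_four`); size `m = 1`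
uses the diagonal floor `K − 1 ≤ n` (`DiagK.le_of_tropRootLawAt`), size `m = 0` and `K ≤ 3` need no height hypothesis.

* `lifting_on_heightZone` — ∀ `m K n`, `TropRootLawAt m K n →` every real symmetric `K`-term pencil of size `m` with all exponents
  `≤ 2^(3K+1)·m` has at most `2^(3K)·(n+1)` distinct real zeros of its determinant (the body of `Lifting` with `C = 3`, support
  quantifier restricted to the height zone);
* `lifting_counterexample_located` — contrapositive: a pencil with more than `2^(3K)·(n+1)` real zeros while `TropRootLawAt m K n` holds
  has `K ≥ 4`, `m ≥ 2` and an exponent `> 2^(3K+1)·m`.  (At `K = 4` the zone is `8192·m` and the tree's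
  `rung_four_counterexample_located` adds `m ≥ 18001`.)

The zone is linear in `m` with constant `2^(3K)` (budget) × `2` (floor coefficient): any better all-`m` tropical floor `c·m²` at `K ≥ 4`
rescales it to `2^(3K−1)·c·m`, and a super-quadratic floor would remove the height hypothesis at that `K` for large `m` (Descartes).
WHAT THIS IS NOT: nothing here touches the fork (`TropicalCensus.TropK4Law 2`), `Lifting` / `WeakLifting` on all supports, `TropicalB`,
`KPlusLogSqLaw`, `MatrixDescartes` (stmt-ValiantsHypothesis-18050) or `VP ≠ VNP`.  Def-free. [folklore] degree count + arithmetic.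
-/

set_option linter.dupNamespace false
set_option autoImplicit false

namespace Summit.ValiantsHypothesis.ValiantsHypothesis.Theorems.KPlusLogSqLaw

open Summit.ValiantsHypothesis.ValiantsHypothesis.Theorems.LacunarySymmetroidMatrixDescartes (RealRootLawAt
  card_roots_det_pencil_le_degree)
open Summit.ValiantsHypothesis.ValiantsHypothesis.Theorems.LacunarySymmetroidMatrixDescartes.TropicalCensus (TropRootLawAt
  grw3_le_of_tropRootLawAt_four)

/-- the arithmetic of the height zone: `m·D ≤ 2^(3K)·(n+1)` once `D ≤ 2^(3K+1)·m` and `2m² ≤ n`. [folklore] -/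
theorem heightZone_arith (m n K D : ℕ) (hD : D ≤ 2 ^ (3 * K + 1) * m) (hn : 2 * m ^ 2 ≤ n) :
    m * D ≤ 2 ^ (3 * K) * (n + 1) := by
  have h1 : m * D ≤ m * (2 ^ (3 * K + 1) * m) := Nat.mul_le_mul_left _ hD
  have h2 : m * (2 ^ (3 * K + 1) * m) = 2 ^ (3 * K) * (2 * m ^ 2) := by ring
  calc m * D ≤ 2 ^ (3 * K) * (2 * m ^ 2) := h2 ▸ h1
    _ ≤ 2 ^ (3 * K) * (n + 1) := Nat.mul_le_mul_left _ (by omega)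

/-- sizes `m ≤ 1` are Descartes-vacuous at every `K ≥ 1`: `2·C(m+K−1, m) − 1 ≤ 2K − 1 ≤ 2^(3K)`, whatever the support. [folklore] -/
theorem realRootLawAt_small_size (m K : ℕ) (hm : m ≤ 1) (hK : 1 ≤ K) : RealRootLawAt m K (2 ^ (3 * K)) := by
  refine LacunarySymmetroidMatrixDescartes.Census.realRootLawAt_mono ?_
    (LacunarySymmetroidMatrixDescartes.Census.realRootLawAt_descartes m K (by omega))
  have hK2 : K < 2 ^ K := Nat.lt_two_pow_self
  have hpow : 2 ^ (K + 1) ≤ 2 ^ (3 * K) := Nat.pow_le_pow_right (by norm_num) (by omega)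
  rw [pow_succ] at hpow
  interval_cases m
  · rw [Nat.choose_zero_right]; omega
  · rw [show 1 + K - 1 = K by omega, Nat.choose_one_right]; omega

/-- **LIFT with `C = 3` on the height zone, EVERY format `(m, K)`:** if every `(m,K)` dominance design has at most `n` alternations
(`TropRootLawAt m K n`), then every real symmetric `K`-term lacunary pencil of size `m` whose exponents are all `≤ 2^(3K+1)·m` has at most
`2^(3K)·(n+1)` distinct real zeros of its determinant.  `K ≤ 3`: the tree's strip `lift_strip_le_three` (all supports); `K ≥ 4`, `m ≤ 1`:
Descartes-vacuous (all supports); `K ≥ 4`, `m ≥ 2`: degree ceiling `card_roots_det_pencil_le_degree` against the tropical floor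
`2m² ≤ n` (class padding `tropRootLawAt_of_le_classes` + GRW `grw3_le_of_tropRootLawAt_four`). [folklore] -/
theorem lifting_on_heightZone (m K n : ℕ) (h : TropRootLawAt m K n) (d : Fin K → ℕ) (hd : ∀ l, d l ≤ 2 ^ (3 * K + 1) * m)
    (S : Fin K → Matrix (Fin m) (Fin m) ℝ) (hS : ∀ l, (S l).IsSymm) :
    (Matrix.det (∑ l, ((Polynomial.X : Polynomial ℝ) ^ d l) • (S l).map Polynomial.C)).roots.toFinset.card
      ≤ 2 ^ (3 * K) * (n + 1) := by
  by_cases hK : K ≤ 3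
  · exact lift_strip_le_three m K n hK h d S hS
  · have hK4 : 4 ≤ K := by omega
    rcases Nat.lt_or_ge m 2 with hm | hm
    · refine (realRootLawAt_small_size m K (by omega) (by omega) d S hS).trans ?_
      exact Nat.le_mul_of_pos_right _ (Nat.succ_pos n)
    · have hfloor : 2 * m ^ 2 ≤ n := grw3_le_of_tropRootLawAt_four m n hm (tropRootLawAt_of_le_classes hK4 h)
      exact (card_roots_det_pencil_le_degree d S (2 ^ (3 * K + 1) * m) hd).trans (heightZone_arith m n K _ le_rfl hfloor)

/-- **Location of any counterexample to LIFT-with-`C = 3`:** if a real symmetric `K`-term pencil of size `m` has more than `2^(3K)·(n+1)`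
distinct real zeros while `TropRootLawAt m K n` holds, then `K ≥ 4`, `m ≥ 2` and some exponent exceeds `2^(3K+1)·m`. [folklore] -/
theorem lifting_counterexample_located (m K n : ℕ) (h : TropRootLawAt m K n) (d : Fin K → ℕ)
    (S : Fin K → Matrix (Fin m) (Fin m) ℝ) (hS : ∀ l, (S l).IsSymm)
    (hbig : 2 ^ (3 * K) * (n + 1) <
      (Matrix.det (∑ l, ((Polynomial.X : Polynomial ℝ) ^ d l) • (S l).map Polynomial.C)).roots.toFinset.card) :
    4 ≤ K ∧ 2 ≤ m ∧ ∃ l, 2 ^ (3 * K + 1) * m < d l := by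
  have hK4 : 4 ≤ K := by
    by_contra hK
    exact absurd (lift_strip_le_three m K n (by omega) h d S hS) (not_le.mpr hbig)
  refine ⟨hK4, ?_, ?_⟩
  · by_contra hm
    refine absurd ((realRootLawAt_small_size m K (by omega) (by omega) d S hS).trans ?_) (not_le.mpr hbig)
    exact Nat.le_mul_of_pos_right _ (Nat.succ_pos n)
  · by_contra hno
    push Not at hno
    exact absurd (lifting_on_heightZone m K n h d hno S hS) (not_le.mpr hbig)

end Summit.ValiantsHypothesis.ValiantsHypothesis.Theorems.KPlusLogSqLaw
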